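import Literature.Analysis.FluidPDE.PassiveVectorTensorCubeDescentApprox
import Literature.Analysis.FluidPDE.PassiveVectorTensorCubeDescentDecay
import HarnessLib

/-!
# Decay above an empty block up to the descent leakage — best-approximation form of the carrier's spectral tail

Analysis/FluidPDE proof-support file (everything proved; no definitions, no named facts).  Same statement and proof as
`PassiveVectorTensorCubeDescentDecay.ae_integral_norm_sq_le_exp_add_leak`, with the slices of the carrier measured by their sup-norm
distance to SOME real trigonometric polynomial with frequencies in the cube `‖k‖_∞ ≤ nS − 2Δ` instead of to their sharp Fourier
truncations (cell note F-k3l-8: sharp truncation costs a Lebesgue constant the analytic carrier cannot pay): for a.e. `t ∈ (0,τ)`,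
`Σ_{|k|≤L'} |ŵ(t)(k)|² ≤ x^{−2(J+1)}‖w₀‖²` and `‖w(t)‖² ≤ (e^{−8π² lo L'² t} + x^{−2(J+1)}) ‖w₀‖²` (`ae_integral_norm_sq_le_exp_add_leak'`).
Consumer: cell `ad-ideate`, K1L_D `stmt-AnomalousDissipation-27980`, W3-E (ii) `stub_effectiveFrameEnergyL_bandKill`.
## Mathlib / tree search
Tree: `PassiveVectorTensorCubeDescentDecay` (`sum_freqBall_sq_norm_le_rungEnergy`, `le_mul_exp_neg_of_two_point_ineq`, the sharp version),
`PassiveVectorTensorCubeDescentApprox.ae_rungEnergy_le_of_datum_off_ladder'`, `PassiveVectorTensorDissipationDensity.exists_dissipationDensity`.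
## References
* R. Temam, *Navier–Stokes Equations* (1984), Ch. III §1 Lemma 1.2. [`Temam1984`]
* R. J. DiPerna, P.-L. Lions, Invent. Math. 98 (1989), §II.1 Lemma II.1. [`DiPernaLions1989`] -/

noncomputable section

open MeasureTheory Set Filter Complex UnitAddTorus Function Finset
open scoped ENNReal InnerProductSpace ComplexConjugate Topology

namespace Literature.Analysis.FluidPDE

namespace Torus

variable {d : Type*} [Fintype d] [DecidableEq d]

namespace IsWeakTensorPassiveVectorOn


/-- **DECAY ABOVE AN EMPTY BLOCK, UP TO THE LEAKAGE — best-approximation form of the spectral tail** (F-k3l-8).  In the setting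
of `ae_rungEnergy_le_of_datum_off_ladder'` with
`0 < lo`, a bounded carrier and `M₀² = ‖w₀‖²`: if the Euclidean ball of radius `L'` lies in the plateau of the last rung
(`L' ≤ K₀ − J S`), then for a.e. `t ∈ (0,τ)` (i) the energy below `L'` is at most `x^{−2(J+1)} ‖w₀‖²` and (ii) the total
energy obeys `‖w(t)‖² ≤ (e^{−8π² lo L'² t} + x^{−2(J+1)}) ‖w₀‖²` — above `L'` the tensor dissipates at rate `8π² lo L'²`
(`lo_mul_le_re_inner_symbT` + the dissipation density of `exists_dissipationDensity`), below `L'` only the leakage lives.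
[cite: Temam1984, Ch. III §1 Lemma 1.2] [cite: DiPernaLions1989, §II.1 Lemma II.1] -/
theorem ae_integral_norm_sq_le_exp_add_leak' {T : ℝ} {𝔸 : Visc4 d} {b w : ℝ → UnitAddTorus d → EuclideanSpace ℝ d}
    {w₀ : UnitAddTorus d → EuclideanSpace ℝ d} (h : IsWeakTensorPassiveVectorOn 0 T 𝔸 b w₀ w)
    {lo hi : ℝ} (h𝔸 : NearIso 𝔸 lo hi) (hlo : 0 < lo)
    (hw₀ : MemLp w₀ 2 volume) (hdiv₀ : FunctionSpaces.Torus.IsWeaklyDivFree w₀)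
    (hb : MemLp (FunctionSpaces.Torus.stLift b) ∞ (volume.restrict (Ioo 0 T ×ˢ univ)))
    {K₀ S Δ J : ℕ} (hΔ : 0 < Δ) (hS : 2 * Δ ≤ S) (hJ : (J + 1) * S ≤ K₀ + S)
    (hoff : ∀ k ∈ FunctionSpaces.Torus.ladderSupp d K₀ S Δ, mFourierCoeff (FunctionSpaces.EuclideanSpace.complexify ∘ w₀) k = 0)
    (hbc : ∀ᵐ s ∂(volume.restrict (Ioo 0 T)), Continuous (b s))
    {Λ : ℝ} (hΛ : 0 ≤ Λ) (hbL : ∀ᵐ s ∂(volume.restrict (Ioo 0 T)), ∀ x y, ‖b s x - b s y‖ ≤ Λ * ‖FunctionSpaces.Torus.reprc (x - y)‖)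
    {W : ℕ → ℝ} (hW0 : ∀ n, 0 ≤ W n)
    (hW : ∀ᵐ s ∂(volume.restrict (Ioo 0 T)), ∀ n, 1 ≤ n → n ≤ J + 1 → ∃ t : (d → ℤ) → EuclideanSpace ℂ d,
      FunctionSpaces.Torus.IsConjSymm t ∧
        ∀ x, ‖b s x - FunctionSpaces.Torus.realTrigPoly (FunctionSpaces.Torus.cubeSupp d (n * S - 2 * Δ)) t x‖ ≤ W n)
    {τ x : ℝ} (hτ : 0 < τ) (hτT : τ ≤ T) (hx : 1 ≤ x)
    (hladder : 4 * Real.pi * (K₀ + 2 * Δ) * τ * x *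
      (2 * (Fintype.card d) ^ 2 * Λ / Δ + Fintype.card d * ∑ n ∈ Finset.range (J + 1), W (n + 1) * x ^ (n + 1)) ≤ 1)
    {L' : ℕ} (hL' : L' ≤ FunctionSpaces.Torus.rungHeight K₀ S (J + 1)) :
    ∀ᵐ t ∂(volume.restrict (Ioo 0 τ)),
      (∑ k ∈ FunctionSpaces.Torus.freqBall L', ‖mFourierCoeff (FunctionSpaces.EuclideanSpace.complexify ∘ w t) k‖ ^ 2 ≤
          (x⁻¹ ^ (J + 1)) ^ 2 * ∫ y, ‖w₀ y‖ ^ 2) ∧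
      (∫ y, ‖w t y‖ ^ 2 ≤
        (Real.exp (-(8 * Real.pi ^ 2 * lo * (L' : ℝ) ^ 2 * t)) + (x⁻¹ ^ (J + 1)) ^ 2) * ∫ y, ‖w₀ y‖ ^ 2) := by
  classical
  -- ### notation
  set X : (d → ℤ) → ℝ → EuclideanSpace ℂ d := fun k s =>
    mFourierCoeff (FunctionSpaces.EuclideanSpace.complexify ∘ w s) k with hX
  set E : ℝ → ℝ := fun s => ∫ y, ‖w s y‖ ^ 2 with hE
  set Y : ℝ := ∫ y, ‖w₀ y‖ ^ 2 with hY
  set P : ℝ → ℝ := fun s => ∑ k ∈ FunctionSpaces.Torus.freqBall L', ‖X k s‖ ^ 2 with hP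
  set ε2 : ℝ := (x⁻¹ ^ (J + 1)) ^ 2 with hε2
  set r : ℝ := 8 * Real.pi ^ 2 * lo * (L' : ℝ) ^ 2 with hr
  have hY0 : 0 ≤ Y := integral_nonneg fun y => sq_nonneg _
  have hε20 : 0 ≤ ε2 := sq_nonneg _
  have hr0 : 0 ≤ r := by positivity
  have hsubT : Ioo (0:ℝ) τ ⊆ Ioo 0 T := Ioo_subset_Ioo le_rfl hτT
  have hres : ∀ {Q : ℝ → Prop}, (∀ᵐ s ∂(volume.restrict (Ioo 0 T)), Q s) → ∀ᵐ s ∂(volume.restrict (Ioo 0 τ)), Q s :=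
    fun hQ => ae_restrict_of_ae_restrict_of_subset hsubT hQ
  -- ### the energy bound and the descent
  have hEle : ∀ᵐ t ∂(volume.restrict (Ioo 0 T)), E t ≤ Real.sqrt Y ^ 2 := by
    filter_upwards [h.ae_integral_norm_sq_le h𝔸 hlo hw₀ hdiv₀ hb] with t ht
    rwa [Real.sq_sqrt hY0]
  have hdesc := h.ae_rungEnergy_le_of_datum_off_ladder' h𝔸 hlo.le hw₀ hdiv₀ (Real.sqrt_nonneg Y) hEle hΔ hS hJ hoff hbc hΛ
    hbL hW0 hW hτ.le hτT hx hladder (J + 1) le_rfl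
  have hPle : ∀ᵐ t ∂(volume.restrict (Ioo 0 τ)), P t ≤ ε2 * Y := by
    filter_upwards [hdesc] with t ht
    calc P t ≤ FunctionSpaces.Torus.rungEnergy K₀ S Δ (J + 1) (w t) :=
          FunctionSpaces.Torus.sum_freqBall_sq_norm_le_rungEnergy hΔ hL' (w t)
      _ ≤ Real.sqrt Y ^ 2 * (x⁻¹ ^ (J + 1)) ^ 2 := ht
      _ = ε2 * Y := by rw [Real.sq_sqrt hY0, hε2, mul_comm]
  -- ### the dissipation density and its lower bound above `L'`
  obtain ⟨q, hqint, hqQ, hq0, hqE⟩ := h.exists_dissipationDensity h𝔸 hlo hw₀ hdiv₀ hb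
  have htr := ae_all_iff.2 fun k => h.ae_sum_mul_mFourierCoeff_eq_zero k
  have hlow : ∀ᵐ s ∂(volume.restrict (Ioo 0 τ)), r / 2 * (E s - ε2 * Y) ≤ q s := by
    filter_upwards [hres hqQ, hres htr, hres h.ae_memLp_two, hPle] with s hsQ hs_tr hs2 hsP
    -- partial sums
    have hmain : ∀ N : ℕ, L' ≤ N → r / 2 * (∑ k ∈ FunctionSpaces.Torus.freqBall N, ‖X k s‖ ^ 2 - P s) ≤ q s := by
      intro N hN
      refine le_trans ?_ (hsQ N)
      have hball : FunctionSpaces.Torus.freqBall (d := d) L' ⊆ FunctionSpaces.Torus.freqBall N :=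
        FunctionSpaces.Torus.freqBall_mono hN
      rw [hP]
      simp only
      rw [← Finset.sum_sdiff hball, add_sub_cancel_right, hr, Finset.mul_sum, Finset.mul_sum]
      have hsplit : ∑ k ∈ FunctionSpaces.Torus.freqBall N, 4 * Real.pi ^ 2 * (⟪X k s, symbT 𝔸 k (X k s)⟫_ℂ).re =
          ∑ k ∈ FunctionSpaces.Torus.freqBall N \ FunctionSpaces.Torus.freqBall L', 4 * Real.pi ^ 2 * (⟪X k s, symbT 𝔸 k (X k s)⟫_ℂ).re +
          ∑ k ∈ FunctionSpaces.Torus.freqBall L', 4 * Real.pi ^ 2 * (⟪X k s, symbT 𝔸 k (X k s)⟫_ℂ).re :=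
        (Finset.sum_sdiff hball).symm
      rw [hsplit]
      have hnn : 0 ≤ ∑ k ∈ FunctionSpaces.Torus.freqBall L', 4 * Real.pi ^ 2 * (⟪X k s, symbT 𝔸 k (X k s)⟫_ℂ).re :=
        Finset.sum_nonneg fun k _ => mul_nonneg (by positivity)
          (le_trans (mul_nonneg hlo.le (mul_nonneg (FunctionSpaces.Torus.freqNormSq_nonneg k) (sq_nonneg _)))
            (lo_mul_le_re_inner_symbT h𝔸 (hs_tr k)))
      refine le_trans (Finset.sum_le_sum fun k hk => ?_) (le_add_of_nonneg_right hnn)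
      rw [Finset.mem_sdiff] at hk
      have hkL : (L' : ℝ) ^ 2 ≤ FunctionSpaces.Torus.freqNormSq k := by
        have := hk.2; rw [FunctionSpaces.Torus.mem_freqBall, not_le] at this; exact this.le
      have hco := lo_mul_le_re_inner_symbT h𝔸 (hs_tr k)
      have : 8 * Real.pi ^ 2 * lo * (L' : ℝ) ^ 2 / 2 * ‖X k s‖ ^ 2 ≤ 4 * Real.pi ^ 2 * (lo * (FunctionSpaces.Torus.freqNormSq k * ‖X k s‖ ^ 2)) := by
        have h1 : lo * ((L' : ℝ) ^ 2 * ‖X k s‖ ^ 2) ≤ lo * (FunctionSpaces.Torus.freqNormSq k * ‖X k s‖ ^ 2) :=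
          mul_le_mul_of_nonneg_left (mul_le_mul_of_nonneg_right hkL (sq_nonneg _)) hlo.le
        have h2 := mul_le_mul_of_nonneg_left h1 (show (0:ℝ) ≤ 4 * Real.pi ^ 2 by positivity)
        linarith
      exact this.trans (mul_le_mul_of_nonneg_left hco (by positivity))
    -- pass to the limit `N → ∞`
    have hlim : Tendsto (fun N : ℕ => r / 2 * (∑ k ∈ FunctionSpaces.Torus.freqBall N, ‖X k s‖ ^ 2 - P s)) atTop
        (𝓝 (r / 2 * (E s - P s))) :=
      (((FunctionSpaces.Torus.hasSum_sq_norm_mFourierCoeff_complexify hs2).comp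
        FunctionSpaces.Torus.tendsto_freqBall_atTop).sub_const _).const_mul _
    have h1 : r / 2 * (E s - P s) ≤ q s :=
      le_of_tendsto hlim (Filter.eventually_atTop.2 ⟨L', fun N hN => hmain N hN⟩)
    have h2 : r / 2 * (E s - ε2 * Y) ≤ r / 2 * (E s - P s) := by
      refine mul_le_mul_of_nonneg_left ?_ (by positivity); linarith
    exact h2.trans h1
  have hlow' := (ae_restrict_iff' (measurableSet_Ioo : MeasurableSet (Ioo (0:ℝ) τ))).1 hlow
  have hq0' := (ae_restrict_iff' (measurableSet_Ioo : MeasurableSet (Ioo (0:ℝ) T))).1 hq0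
  -- ### the continuous representative `Et t = Y − 2 ∫_{(0,t]} q`
  set Et : ℝ → ℝ := fun t => Y - 2 * ∫ s in Ioc 0 t, q s with hEt
  have hrep : ∀ᵐ t ∂(volume : Measure ℝ), t ∈ Ioo 0 T → Et t = E t := by
    refine (ae_restrict_iff' measurableSet_Ioo).1 ?_
    filter_upwards [hqE] with t ht
    simp only [hEt, ht, hY, hE]; ring
  have hEint : IntegrableOn E (Ioo 0 T) := h.integrableOn_integral_norm_sq
  -- splitting `∫_{(0,s₂]} q = ∫_{(0,s₁]} q + ∫_{(s₁,s₂]} q`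
  have hsplitI : ∀ s₁ s₂, 0 ≤ s₁ → s₁ ≤ s₂ → s₂ < T →
      ∫ s in Ioc 0 s₂, q s = (∫ s in Ioc 0 s₁, q s) + ∫ s in Ioc s₁ s₂, q s := by
    intro s₁ s₂ h0 h12 h2T
    have hd : Disjoint (Ioc (0:ℝ) s₁) (Ioc s₁ s₂) := Set.Ioc_disjoint_Ioc_of_le le_rfl
    have hi1 : IntegrableOn q (Ioc 0 s₁) := hqint.mono_set fun ρ hρ => ⟨hρ.1, hρ.2.trans_lt (h12.trans_lt h2T)⟩
    have hi2 : IntegrableOn q (Ioc s₁ s₂) := hqint.mono_set fun ρ hρ => ⟨h0.trans_lt hρ.1, hρ.2.trans_lt h2T⟩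
    rw [← setIntegral_union hd measurableSet_Ioc hi1 hi2, Set.Ioc_union_Ioc_eq_Ioc h0 h12]
  -- `Et` is nonincreasing on `[0, t]` for `t < T`
  have hanti : ∀ t, t < T → AntitoneOn Et (Icc 0 t) := by
    intro t htT s₁ hs₁ s₂ hs₂ h12
    simp only [hEt]
    have hsubI : Ioc s₁ s₂ ⊆ Ioo 0 T := fun r hr => ⟨hs₁.1.trans_lt hr.1, hr.2.trans_lt (hs₂.2.trans_lt htT)⟩
    have hnn : 0 ≤ ∫ s in Ioc s₁ s₂, q s :=
      setIntegral_nonneg_of_ae_restrict ((ae_restrict_iff' measurableSet_Ioc).2 (hq0'.mono fun r hr hrI => hr (hsubI hrI)))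
    rw [hsplitI s₁ s₂ hs₁.1 h12 (hs₂.2.trans_lt htT)]; linarith
  -- ### conclude at a.e. `t ∈ (0,τ)`
  filter_upwards [hPle, (ae_restrict_iff' measurableSet_Ioo).2 (hrep.mono fun t ht htI => ht (hsubT htI)),
    ae_restrict_mem (measurableSet_Ioo : MeasurableSet (Ioo (0:ℝ) τ))] with t hPt hrept htI
  have htT : t < T := htI.2.trans_le hτT
  refine ⟨by rw [hε2] at hPt; exact hPt, ?_⟩
  -- the two-point inequality for `g = Et − ε2 Y` on `[0, t]`
  set g : ℝ → ℝ := fun s => Et s - ε2 * Y with hg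
  have htwo : ∀ s₁ s₂, 0 ≤ s₁ → s₁ ≤ s₂ → s₂ ≤ t → g s₂ * (1 + r * (s₂ - s₁)) ≤ g s₁ := by
    intro s₁ s₂ h0 h12 h2t
    have hsubI : Ioc s₁ s₂ ⊆ Ioo 0 τ := fun ρ hρ => ⟨h0.trans_lt hρ.1, hρ.2.trans_lt (h2t.trans_lt htI.2)⟩
    have hsubI' : Ioc s₁ s₂ ⊆ Ioo 0 T := hsubI.trans hsubT
    have hdiff : g s₁ - g s₂ = 2 * ∫ s in Ioc s₁ s₂, q s := by
      simp only [hg, hEt]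
      rw [hsplitI s₁ s₂ h0 h12 (h2t.trans_lt htT)]; ring
    -- lower bound of the middle integral
    have hEI : IntegrableOn (fun s => r / 2 * (E s - ε2 * Y)) (Ioc s₁ s₂) :=
      ((hEint.mono_set hsubI').sub (integrableOn_const (by rw [Real.volume_Ioc]; exact ENNReal.ofReal_ne_top))).const_mul _
    have hlowI : ∫ s in Ioc s₁ s₂, r / 2 * (E s - ε2 * Y) ≤ ∫ s in Ioc s₁ s₂, q s :=
      integral_mono_ae hEI (hqint.mono_set hsubI')
        ((ae_restrict_iff' measurableSet_Ioc).2 (hlow'.mono fun ρ hρ hρI => hρ (hsubI hρI)))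
    -- replace `E` by `Et` and use monotonicity
    have hantiT := hanti t htT
    have hEtI : IntegrableOn Et (Ioc s₁ s₂) :=
      ((hantiT.mono (Icc_subset_Icc h0 h2t)).integrableOn_isCompact isCompact_Icc).mono_set Ioc_subset_Icc_self
    have hgI : IntegrableOn (fun s => r / 2 * (Et s - ε2 * Y)) (Ioc s₁ s₂) :=
      (hEtI.sub (integrableOn_const (by rw [Real.volume_Ioc]; exact ENNReal.ofReal_ne_top))).const_mul _
    have hrepI : ∫ s in Ioc s₁ s₂, r / 2 * (E s - ε2 * Y) = ∫ s in Ioc s₁ s₂, r / 2 * (Et s - ε2 * Y) := by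
      refine setIntegral_congr_ae measurableSet_Ioc ?_
      filter_upwards [hrep] with ρ hρ hρI
      rw [hρ (hsubI' hρI)]
    have hmonoI : ∫ _ in Ioc s₁ s₂, r / 2 * (Et s₂ - ε2 * Y) ≤ ∫ s in Ioc s₁ s₂, r / 2 * (Et s - ε2 * Y) := by
      refine setIntegral_mono_on (integrableOn_const (by rw [Real.volume_Ioc]; exact ENNReal.ofReal_ne_top)) hgI
        measurableSet_Ioc fun ρ hρ => ?_
      refine mul_le_mul_of_nonneg_left ?_ (by positivity)
      linarith [hantiT ⟨h0.trans hρ.1.le, hρ.2.trans h2t⟩ ⟨h0.trans h12, h2t⟩ hρ.2]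
    have hconst : ∫ _ in Ioc s₁ s₂, r / 2 * (Et s₂ - ε2 * Y) = (s₂ - s₁) * (r / 2 * (Et s₂ - ε2 * Y)) := by
      rw [setIntegral_const, smul_eq_mul, Real.volume_real_Ioc_of_le h12]
    have key : (s₂ - s₁) * (r / 2 * g s₂) ≤ (g s₁ - g s₂) / 2 := by
      rw [hdiff]
      simp only [hg]
      linarith [hmonoI, hlowI, hrepI, hconst]
    linarith [key]
  have hdec := le_mul_exp_neg_of_two_point_ineq (g := g) hr0 htI.1.le htwo
  have hg0 : g 0 = Y - ε2 * Y := by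
    simp only [hg, hEt]
    rw [Set.Ioc_self, Measure.restrict_empty, integral_zero_measure, mul_zero, sub_zero]
  have hgt : g t = E t - ε2 * Y := by simp only [hg]; rw [hrept]
  rw [hgt, hg0] at hdec
  have hexp0 : 0 ≤ Real.exp (-(r * t)) := (Real.exp_pos _).le
  have h3 : (Y - ε2 * Y) * Real.exp (-(r * t)) ≤ Y * Real.exp (-(r * t)) :=
    mul_le_mul_of_nonneg_right (by nlinarith) hexp0
  have e : Real.exp (-(8 * Real.pi ^ 2 * lo * (L' : ℝ) ^ 2 * t)) = Real.exp (-(r * t)) := by rw [hr]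
  rw [e]
  linarith [hdec, h3]

end IsWeakTensorPassiveVectorOn

end Torus

end Literature.Analysis.FluidPDE

end
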